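import Literature.NumberTheory.EllipticCurves.NewformPeterssonSizeSymmSquareConverseProofs
import Literature.NumberTheory.LFunctions.SiegelTheoremPairAbstract
import HarnessLib

/-!
# `murty_petersson_newform_lower_bound` from a Siegel pair family for the symmetric squares of
# elliptic newforms (the shape of Hoffstein–Lockhart's Theorem 0.1)

Topic `Literature/NumberTheory/EllipticCurves`; one index `structure` and theorems (no named fact).
Continues `NewformPeterssonSizeSymmSquareConverseProofs` (the named fact
`murty_petersson_newform_lower_bound` — `Re(f,f) ≥ c(ε)N^{1−ε}` for the newform `f` of an elliptic
curve over `ℚ` of conductor `N` — is EQUIVALENT to `symmSqLOne f ≥ c'(ε) N^{−ε}`,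
`murty_petersson_newform_lower_bound_iff_symmSqLOne_lower_bound`, where
`symmSqLOne f = 8π³ Re(f,f)/N` is the naive symmetric-square value at the edge, `symmSqLOne_eq`) and
`Literature/NumberTheory/LFunctions/SiegelTheoremPairAbstract` (Siegel's theorem for an abstract
family with external pair functions, `SiegelPairFamilyData.siegel`: `Re L_i(1) ≥ C(ε) Q_i^{−ε}`).

Hoffstein–Lockhart (Ann. of Math. 140 (1994), Theorem 0.1; Iwaniec–Kowalski, Corollary 5.45) prove
`L(1, Sym² f) ≫_ε N^{−ε}` by running Siegel's argument for the family of symmetric squares, the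
auxiliary product for a pair being `ζ(s)L(s, Sym² f)L(s, Sym² g)L(s, Sym² f × Sym² g)`. This file
records the formal consequence for the named fact: **if** the symmetric squares of the newforms of
elliptic curves over `ℚ` (or of those in the range of an index map `idx`, the others being bounded
directly — model: the CM forms, whose symmetric square is not cuspidal) carry the structure of a
`SiegelPairFamilyData` whose sizes are polynomial in the level and whose values at `1` are
`≪_δ N^δ · symmSqLOne f` (model: `L(1, Sym² f)` for the complete `L`-function differs from the naive
edge value by the Euler factors at `p ∣ N`, of total size `N^{o(1)}`), **then**
`murty_petersson_newform_lower_bound` holds (`murty_petersson_newform_lower_bound_of_siegelPairFamilyData`,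
and `…_of_siegelPairFamilyData_univ` when every newform is indexed).

So, given the tree, the residual content of the named fact is to EXHIBIT such a datum, i.e. the
analytic inputs of Hoffstein–Lockhart's proof for `F = Sym² f_E`: holomorphic continuation of
`L(s, Sym² f)` to a neighbourhood of the disc `|s − 2| ≤ R` with a polynomial bound in `N`
(Shimura 1975 / Gelbart–Jacquet 1978), the `GL(3) × GL(3)` Rankin–Selberg convolutions
`L(s, Sym² f × Sym² g)` (entire off twist-equivalence, polynomially bounded, `≪_δ (N_fN_g)^δ` at `1`),
the non-negativity of the coefficients of `ζ·L(Sym² f)` and of the quadruple product, the comparison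
of twist-equivalent members, and the CM members. None of these is claimed here.

* `EllipticNewformIndex` — the index of the family: a level `N ≥ 1`, an elliptic curve `W/ℚ` and
  `f ∈ S₂(Γ₀(N))` with `IsNewformOf W f`.
* `symmSqLOne_lower_bound_of_siegelPairFamilyData` — along any `idx : ι → EllipticNewformIndex`,
  `SiegelPairFamilyData.siegel` with `ε' = ε/(2(k + 1))`, `Q_i ≤ A N^k` and
  `Re L_i(1) ≤ T(δ) N^δ symmSqLOne f_i` give `symmSqLOne f_i ≥ c(ε) N^{−ε}`.
* `murty_petersson_newform_lower_bound_of_siegelPairFamilyData`, `…_univ` — the named fact.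

## References

* J. Hoffstein, P. Lockhart, *Coefficients of Maass forms and the Siegel zero* (appendix by
  D. Goldfeld, J. Hoffstein, D. Lieman), Ann. of Math. (2) 140 (1994), 161–181, Theorem 0.1.
  [cite: HoffsteinLockhart1994, Thm. 0.1] (not held.)
* H. Iwaniec, E. Kowalski, *Analytic Number Theory*, AMS Colloq. Publ. 53 (2004), Corollary 5.45
  and its proof ("proved by Hoffstein and Lockhart … similar to the proof of Siegel's bound (5.73),
  and the implied constant is not effective"). [cite: IwaniecKowalski2004, §5.12 Cor. 5.45]
* M. R. Murty, *Bounds for congruence primes*, Proc. Sympos. Pure Math. 66.1 (1999), §2.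
  [cite: MurtyCongruencePrimes1999, §2] (not held; as quoted by Pasten, arXiv:1705.09251 p. 13.)

## Mathlib / tree search

Tree: `murty_petersson_newform_lower_bound_of_symmSqLOne_lower_bound` (ConverseProofs),
`SiegelPairFamilyData.siegel` (SiegelTheoremPairAbstract), `symmSqLOne` (CuspFormSymmSquareLSeries).
Mathlib: `Real.rpow_le_rpow_of_nonpos`, `Real.rpow_le_rpow_of_exponent_le`, `Real.mul_rpow`,
`Real.rpow_mul`, `Real.rpow_add`.
-/

noncomputable section

open scoped Real
open CongruenceSubgroup
open Literature.NumberTheory.LFunctions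

namespace Literature.NumberTheory.EllipticCurves.ModularForms

/-- **The index of the family of elliptic newforms**: a level `N ≥ 1`, an elliptic curve `W/ℚ`
and a cusp form `f ∈ S₂(Γ₀(N))` which is THE newform of `W` (`IsNewformOf W f`; then `N = N_W`).
The quantifier prefix of `murty_petersson_newform_lower_bound`, bundled. [folklore] -/
structure EllipticNewformIndex where
  /-- the level -/
  N : ℕ
  [neZero : NeZero N]
  /-- the elliptic curve -/
  W : WeierstrassCurve ℚ
  [isElliptic : W.IsElliptic]
  /-- its newform -/
  f : CuspForm (Gamma0 N) 2
  isNewformOf : IsNewformOf W f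

attribute [instance] EllipticNewformIndex.neZero EllipticNewformIndex.isElliptic

namespace EllipticNewformIndex

/-- The level of a member is positive (as a real number). [folklore] -/
theorem natCast_N_pos (j : EllipticNewformIndex) : (0 : ℝ) < j.N := by
  exact_mod_cast NeZero.pos j.N

/-- The level of a member is `≥ 1` (as a real number). [folklore] -/
theorem one_le_natCast_N (j : EllipticNewformIndex) : (1 : ℝ) ≤ j.N := by
  exact_mod_cast NeZero.one_le

end EllipticNewformIndex

/-- **Siegel along an indexed family of elliptic newforms.** Let `D` be a Siegel pair family on `ι`
and `idx : ι → EllipticNewformIndex`, with sizes `Q_i ≤ A N_i^k` and values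
`Re L_i(1) ≤ T(δ) N_i^δ · symmSqLOne f_i` for every `δ > 0`. Then for every `ε > 0` there is
`c > 0` with `symmSqLOne f_i ≥ c N_i^{−ε}` for all `i`: apply `SiegelPairFamilyData.siegel` with
`ε' = ε/(2(k+1))` (`Q_i^{−ε'} ≥ A^{−ε'} N_i^{−kε'} ≥ A^{−ε'}N_i^{−ε/2}`) and `δ = ε/2`.
[cite: HoffsteinLockhart1994, Thm. 0.1 (scheme)] -/
theorem symmSqLOne_lower_bound_of_siegelPairFamilyData {ι : Type*} (D : SiegelPairFamilyData ι)
    (idx : ι → EllipticNewformIndex) {A k : ℝ} (hA : 0 < A) (hk : 0 ≤ k)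
    (hQ : ∀ i, D.Q i ≤ A * ((idx i).N : ℝ) ^ k)
    (hL : ∀ δ : ℝ, 0 < δ → ∃ T : ℝ, 0 < T ∧
      ∀ i, (D.L i 1).re ≤ T * ((idx i).N : ℝ) ^ δ * symmSqLOne (idx i).f)
    {ε : ℝ} (hε : 0 < ε) :
    ∃ c : ℝ, 0 < c ∧ ∀ i, c * ((idx i).N : ℝ) ^ (-ε) ≤ symmSqLOne (idx i).f := by
  set ε' : ℝ := ε / (2 * (k + 1)) with hε'def
  have hk1 : 0 < 2 * (k + 1) := by linarith
  have hε' : 0 < ε' := div_pos hε hk1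
  have hkε' : k * ε' ≤ ε / 2 := by
    rw [hε'def, mul_div_assoc', div_le_div_iff₀ hk1 two_pos]
    nlinarith
  obtain ⟨C, hC, hCi⟩ := D.siegel hε'
  obtain ⟨T, hT, hTi⟩ := hL (ε / 2) (by positivity)
  refine ⟨C * A ^ (-ε') / T, by positivity, fun i => ?_⟩
  have hN1 : (1 : ℝ) ≤ (idx i).N := (idx i).one_le_natCast_N
  have hN0 : (0 : ℝ) < (idx i).N := (idx i).natCast_N_pos
  have hQ1 : 1 ≤ D.Q i := D.one_le_Q i
  have hQ0 : 0 < D.Q i := by linarith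
  -- `Q_i^{-ε'} ≥ (A N^k)^{-ε'} = A^{-ε'} N^{-kε'} ≥ A^{-ε'} N^{-ε/2}`
  have h1 : (A * ((idx i).N : ℝ) ^ k) ^ (-ε') ≤ D.Q i ^ (-ε') :=
    Real.rpow_le_rpow_of_nonpos hQ0 (hQ i) (by linarith)
  have h2 : (A * ((idx i).N : ℝ) ^ k) ^ (-ε') = A ^ (-ε') * ((idx i).N : ℝ) ^ (-(k * ε')) := by
    rw [Real.mul_rpow hA.le (Real.rpow_nonneg hN0.le _), ← Real.rpow_mul hN0.le]
    congr 1; ring_nf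
  have h3 : ((idx i).N : ℝ) ^ (-(ε / 2)) ≤ ((idx i).N : ℝ) ^ (-(k * ε')) :=
    Real.rpow_le_rpow_of_exponent_le hN1 (by linarith)
  have hAε : 0 < A ^ (-ε') := Real.rpow_pos_of_pos hA _
  have hlow : C * A ^ (-ε') * ((idx i).N : ℝ) ^ (-(ε / 2)) ≤ (D.L i 1).re := by
    calc C * A ^ (-ε') * ((idx i).N : ℝ) ^ (-(ε / 2))
        ≤ C * A ^ (-ε') * ((idx i).N : ℝ) ^ (-(k * ε')) := by gcongr
      _ = C * (A * ((idx i).N : ℝ) ^ k) ^ (-ε') := by rw [h2]; ring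
      _ ≤ C * D.Q i ^ (-ε') := by gcongr
      _ ≤ (D.L i 1).re := hCi i
  -- combine: `C A^{-ε'} N^{-ε/2} ≤ Re L_i(1) ≤ T N^{ε/2} symmSqLOne`
  have key : C * A ^ (-ε') * ((idx i).N : ℝ) ^ (-(ε / 2)) ≤
      T * ((idx i).N : ℝ) ^ (ε / 2) * symmSqLOne (idx i).f := hlow.trans (hTi i)
  have hNε2 : 0 < ((idx i).N : ℝ) ^ (-(ε / 2)) := Real.rpow_pos_of_pos hN0 _
  have hprod : ((idx i).N : ℝ) ^ (-(ε / 2)) * ((idx i).N : ℝ) ^ (ε / 2) = 1 := by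
    rw [← Real.rpow_add hN0, neg_add_cancel, Real.rpow_zero]
  have hsplit : ((idx i).N : ℝ) ^ (-ε) = ((idx i).N : ℝ) ^ (-(ε / 2)) * ((idx i).N : ℝ) ^ (-(ε / 2)) := by
    rw [← Real.rpow_add hN0]; congr 1; ring
  calc C * A ^ (-ε') / T * ((idx i).N : ℝ) ^ (-ε)
      = C * A ^ (-ε') * ((idx i).N : ℝ) ^ (-(ε / 2)) * ((idx i).N : ℝ) ^ (-(ε / 2)) / T := by
        rw [hsplit]; ring
    _ ≤ T * ((idx i).N : ℝ) ^ (ε / 2) * symmSqLOne (idx i).f * ((idx i).N : ℝ) ^ (-(ε / 2)) / T :=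
        div_le_div_of_nonneg_right (mul_le_mul_of_nonneg_right key hNε2.le) hT.le
    _ = symmSqLOne (idx i).f * (((idx i).N : ℝ) ^ (-(ε / 2)) * ((idx i).N : ℝ) ^ (ε / 2)) := by
        field_simp
    _ = symmSqLOne (idx i).f := by rw [hprod, mul_one]

/-- **`murty_petersson_newform_lower_bound` from a Siegel pair family for the symmetric squares of
the (indexed) elliptic newforms** — the formal shape of Hoffstein–Lockhart's Theorem 0.1 as used by
Murty 1999, §2: a `SiegelPairFamilyData` along `idx : ι → EllipticNewformIndex` with `Q_i ≤ A N_i^k`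
and `Re L_i(1) ≤ T(δ) N_i^δ symmSqLOne f_i`, together with a direct bound
`symmSqLOne f ≥ c(ε)N^{−ε}` for the newforms NOT in the range of `idx` (model: the CM forms), imply
the named fact (through `murty_petersson_newform_lower_bound_of_symmSqLOne_lower_bound`).
[cite: HoffsteinLockhart1994, Thm. 0.1] [cite: MurtyCongruencePrimes1999, §2] -/
theorem murty_petersson_newform_lower_bound_of_siegelPairFamilyData {ι : Type*}
    (D : SiegelPairFamilyData ι) (idx : ι → EllipticNewformIndex) {A k : ℝ} (hA : 0 < A) (hk : 0 ≤ k)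
    (hQ : ∀ i, D.Q i ≤ A * ((idx i).N : ℝ) ^ k)
    (hL : ∀ δ : ℝ, 0 < δ → ∃ T : ℝ, 0 < T ∧
      ∀ i, (D.L i 1).re ≤ T * ((idx i).N : ℝ) ^ δ * symmSqLOne (idx i).f)
    (hrest : ∀ ε : ℝ, 0 < ε → ∃ c : ℝ, 0 < c ∧ ∀ j : EllipticNewformIndex, j ∉ Set.range idx →
      c * (j.N : ℝ) ^ (-ε) ≤ symmSqLOne j.f) :
    murty_petersson_newform_lower_bound := by
  refine murty_petersson_newform_lower_bound_of_symmSqLOne_lower_bound fun ε hε => ?_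
  obtain ⟨c₁, hc₁, h₁⟩ := symmSqLOne_lower_bound_of_siegelPairFamilyData D idx hA hk hQ hL hε
  obtain ⟨c₂, hc₂, h₂⟩ := hrest ε hε
  refine ⟨min c₁ c₂, lt_min hc₁ hc₂, fun N _ W _ f hf => ?_⟩
  let j : EllipticNewformIndex := { N := N, W := W, f := f, isNewformOf := hf }
  have hN0 : (0 : ℝ) ≤ (N : ℝ) ^ (-ε) := Real.rpow_nonneg (Nat.cast_nonneg N) _
  by_cases hj : j ∈ Set.range idx
  · obtain ⟨i, hi⟩ := hj
    have h := h₁ i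
    rw [hi] at h
    exact (mul_le_mul_of_nonneg_right (min_le_left _ _) hN0).trans h
  · exact (mul_le_mul_of_nonneg_right (min_le_right _ _) hN0).trans (h₂ j hj)

/-- **The same when every elliptic newform is indexed** (`ι = EllipticNewformIndex`, `idx = id`):
a `SiegelPairFamilyData` on ALL elliptic newforms with `Q ≤ A N^k` and
`Re L(1) ≤ T(δ) N^δ symmSqLOne f` implies `murty_petersson_newform_lower_bound`.
[cite: HoffsteinLockhart1994, Thm. 0.1] -/
theorem murty_petersson_newform_lower_bound_of_siegelPairFamilyData_univ
    (D : SiegelPairFamilyData EllipticNewformIndex) {A k : ℝ} (hA : 0 < A) (hk : 0 ≤ k)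
    (hQ : ∀ j, D.Q j ≤ A * (j.N : ℝ) ^ k)
    (hL : ∀ δ : ℝ, 0 < δ → ∃ T : ℝ, 0 < T ∧ ∀ j, (D.L j 1).re ≤ T * (j.N : ℝ) ^ δ * symmSqLOne j.f) :
    murty_petersson_newform_lower_bound :=
  murty_petersson_newform_lower_bound_of_siegelPairFamilyData D id hA hk hQ hL
    fun _ _ => ⟨1, one_pos, fun j hj => (hj ⟨j, rfl⟩).elim⟩

end Literature.NumberTheory.EllipticCurves.ModularForms

end
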